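import Literature.NumberTheory.DiophantineGeometry.TateAlgorithmInvarianceProofs
import Literature.NumberTheory.DiophantineGeometry.MinimalDiscriminantRingOfIntegersProofs
import Literature.NumberTheory.DiophantineGeometry.Conductor
import HarnessLib

/-!
# Tate's algorithm is equivariant under isomorphisms of discrete valuation rings

Trunk `DiophValNum` (companion proof file of
`Literature.NumberTheory.DiophantineGeometry.TateAlgorithm`; theorems only).

`Literature.NumberTheory.DiophantineGeometry.TateAlgorithmInvarianceProofs` proves that the
literal implementation `WeierstrassCurve.kodairaSymbolOfMinimal` of Tate's algorithm (Silverman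
ATAEC IV.9.4, steps 1–10) over a DVR `R` with perfect residue field is invariant under changes of
variables over `R`.  This file proves the companion statement across a ring isomorphism
`ψ : R₁ ≃+* R₂` of DVRs (perfect residue fields):

* `WeierstrassCurve.kodairaSymbolOfMinimal_map_ringEquiv` —
  `kodairaSymbolOfMinimal (ψW) = kodairaSymbolOfMinimal W` for every `W` over `R₁`;
* `WeierstrassCurve.kodairaSymbol_map_ringEquiv` — for compatible isomorphisms
  `(R₁ ⊆ K₁) ≃ (R₂ ⊆ K₂)` of DVR / fraction-field pairs and `X` over `K₁` with `Δ ≠ 0`,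
  `(φX).kodairaSymbol R₂ = X.kodairaSymbol R₁` (the Kodaira symbol is intrinsic to the valued
  field);
* `WeierstrassCurve.kodairaSymbolAt_eq_padic` — for an elliptic `W / ℚ` and a finite place `v`
  of an integer ring `R` of `ℚ` (`ℤ` or `𝓞 ℚ`) above `p`, `W.kodairaSymbolAt v` is the Kodaira
  symbol of `W ⊗ ℚ_[p]` computed over Mathlib's `ℤ_[p]`
  (`Rat.HeightOneSpectrum.adicCompletionIntegers.padicIntEquiv`); this is the Kodaira-symbol half
  of the `𝓞 ℚ` versus `ℤ` bridge for the conductor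
  (`Literature.NumberTheory.DiophantineGeometry.ConductorRingOfIntegersProofs`), the
  discriminant half being `WeierstrassCurve.ordMinimalDiscriminant_eq_padic`.

## Why this is not a formality

`kodairaSymbolOfMinimal` makes choices that are *not* related by `ψ`: the chosen uniformisers
satisfy only `ψ π₁ = w π₂` for some unit `w` (`exists_units_map_uniformizer`), so the reduced
coefficients `a_{i,j} = π^{-j} aᵢ mod π` of `ψW` are `w̄ʲ ψ̄ (a_{i,j})` (`redCoeff_map`), and the
normalising translations of steps 2, 6, 7, 8, 9 are chosen by `Exists.choose` independently on
the two sides.  The proof couples the run on `W` over `R₁` with the run on `ψW` over `R₂` exactly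
as `kodairaSymbolOfMinimal_smul` couples two runs over one ring: after each normalisation the
`R₂`-model is `Eₖ • ψWₖ` for a change `Eₖ` over `R₂` with `u = 1` which, by the rigidity
lemmas of the invariance file applied over `R₂` (`dvd_r_t_of_step2`, `dvd_r_s_t_of_step6`,
`…step7`, `…step7b`, `…step8`, `…step9`), lies in the subgroup under which the next test is
invariant (`dvd_b₂_smul_iff`, `sq_dvd_a₆_smul_iff`, `cube_dvd_b₈_smul_iff`,
`cube_dvd_b₆_smul_iff`, `distinctRootCount_cubicStep6_smul`, `…quadratic₁/₂_smul`,
`pow_four_dvd_a₄_smul_iff`, `pow_six_dvd_a₆_smul_iff`); and the tests of `ψWₖ` agree with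
those of `Wₖ`: divisibility by powers of the uniformiser and `ord Δ` are transported by `ψ`
(`pow_dvd_map_iff`, `addVal_Δ_map_toNat`), while the step-6 cubic and the quadratics of steps
7–9 of `ψWₖ` are `c · (ψ̄ P)(T / w̄ᵉ)` for units `c` and exponents `e`
(`distinctRootCount_cubicStep6_map`, `…quadratic₁_map`, `…quadratic₂_map`), which have as many
distinct roots in `k̄₂` as `P` has in `k̄₁` (`distinctRootCount_map_ringHom`, via a
`k₁`-embedding `k̄₁ → k̄₂`, and `distinctRootCount_C_mul_comp`).  The `Iₙ*` sub-procedure is a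
coupled induction on the fuel (`istarIndexAux_map_eq`, `istarIndex_map_eq`).  Perfectness of
the residue fields enters only through the existence of the normalising translations
(`exists_variableChange_step2_of_perfectField`, `exists_variableChange_step6/7/8/9_of_dvd`,
`exists_normalize_istarA/B`), so that no junk branch is taken on either side.

Over the fraction fields, `(φX).minimal R₂` and `φ (X.minimal R₁)` are minimal equations of the
same elliptic curve (`isMinimal_map_ringEquiv`), their integral models differ by a change of
variables over `R₂` (Silverman AEC VII.1.3(b), `exists_variableChange_integralModel_eq`), and the
integral model of `φ (X.minimal R₁)` is `ψ` of that of `X.minimal R₁`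
(`integralModel_map_eq_map_integralModel`), whence `kodairaSymbol_map_ringEquiv` from the two DVR
theorems.

## References

* J. H. Silverman, *Advanced Topics in the Arithmetic of Elliptic Curves*, GTM 151, 1994, IV.9,
  Tate's algorithm 9.4, Steps 1–11 (PDF pp. 344–346) and Rem. IV.9.5; proofs of Steps 7 and 11
  (PDF pp. 351–355).
* J. Tate, *Algorithm for determining the type of a singular fiber in an elliptic pencil*, in
  Modular Functions of One Variable IV, LNM 476, 1975, §§7–8.
* J. H. Silverman, *The Arithmetic of Elliptic Curves*, GTM 106, 2nd ed. 2009, VII.1.3(b).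
-/

open Polynomial IsLocalRing

namespace Literature.NumberTheory.DiophantineGeometry

namespace TateAlgorithm

/-! ### Transport of the basic quantities along `ψ : R₁ ≃+* R₂` -/

section Transport

variable {R₁ R₂ : Type*} [CommRing R₁] [IsDomain R₁] [IsDiscreteValuationRing R₁]
  [CommRing R₂] [IsDomain R₂] [IsDiscreteValuationRing R₂] (ψ : R₁ ≃+* R₂)

/-- A ring isomorphism of DVRs maps the chosen uniformiser of `R₁` to a uniformiser of `R₂`,
i.e. to a unit multiple of the chosen uniformiser of `R₂`. [folklore] -/
theorem exists_units_map_uniformizer :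
    ∃ w : R₂ˣ, ψ (uniformizer R₁) = ↑w * uniformizer R₂ := by
  have h₁ : Irreducible (ψ (uniformizer R₁)) :=
    (MulEquiv.irreducible_iff (ψ : R₁ ≃* R₂)).mpr irreducible_uniformizer
  obtain ⟨w, hw⟩ := IsDiscreteValuationRing.associated_of_irreducible R₂
    irreducible_uniformizer h₁
  exact ⟨w, by rw [← hw, mul_comm]⟩

/-- `π₂ ^ n ∣ ψ x ↔ π₁ ^ n ∣ x`. [folklore] -/
theorem pow_dvd_map_iff (x : R₁) (n : ℕ) :
    uniformizer R₂ ^ n ∣ ψ x ↔ uniformizer R₁ ^ n ∣ x := by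
  rw [pow_dvd_iff_le_addVal, pow_dvd_iff_le_addVal, Literature.NumberTheory.DiophantineGeometry.MinimalDiscriminant.addVal_ringEquiv]

/-- `π₂ ∣ ψ x ↔ π₁ ∣ x`. [folklore] -/
theorem dvd_map_iff (x : R₁) : uniformizer R₂ ∣ ψ x ↔ uniformizer R₁ ∣ x := by
  simpa using pow_dvd_map_iff ψ x 1

/-- `ψ x ∈ 𝔪₂ ^ n ↔ x ∈ 𝔪₁ ^ n`. [folklore] -/
theorem map_mem_maximalIdeal_pow_iff (x : R₁) (n : ℕ) :
    ψ x ∈ maximalIdeal R₂ ^ n ↔ x ∈ maximalIdeal R₁ ^ n := by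
  rw [mem_maximalIdeal_pow_iff_dvd, mem_maximalIdeal_pow_iff_dvd, pow_dvd_map_iff]

/-- `ψ x ∈ 𝔪₂ ↔ x ∈ 𝔪₁`. [folklore] -/
theorem map_mem_maximalIdeal_iff (x : R₁) : ψ x ∈ maximalIdeal R₂ ↔ x ∈ maximalIdeal R₁ := by
  rw [mem_maximalIdeal_iff_dvd, mem_maximalIdeal_iff_dvd, dvd_map_iff]

/-- Transport of `redCoeff`: if `ψ π₁ = w π₂` then `(ψ a)_{·,j} = w̄ ^ j · ψ̄ (a_{·,j})` (both sides
are `0` in the junk case `π ^ j ∤ a`). [folklore] -/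
theorem redCoeff_map {w : R₂ˣ} (hw : ψ (uniformizer R₁) = ↑w * uniformizer R₂) (a : R₁) (j : ℕ) :
    redCoeff (ψ a) j =
      residue R₂ ↑w ^ j * ResidueField.map (ψ : R₁ →+* R₂) (redCoeff a j) := by
  by_cases h : uniformizer R₁ ^ j ∣ a
  · have h' : uniformizer R₂ ^ j ∣ ψ a := (pow_dvd_map_iff ψ a j).mpr h
    have e₁ := divPow_spec h
    have e₂ := divPow_spec h'
    have key : divPow (ψ a) j = ↑w ^ j * ψ (divPow a j) := by
      apply mul_left_cancel₀ (pow_ne_zero j (irreducible_uniformizer (R := R₂)).ne_zero)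
      rw [← e₂]
      conv_lhs => rw [e₁, map_mul, map_pow, hw]
      ring
    rw [redCoeff, key, map_mul, map_pow, redCoeff]
    rfl
  · have h' : ¬ uniformizer R₂ ^ j ∣ ψ a := fun h' ↦ h ((pow_dvd_map_iff ψ a j).mp h')
    classical
    simp [redCoeff, divPow, h, h']

end Transport

/-! ### Distinct-root counts under a change of residue field and under the twist `π ↦ w π` -/

section RootCount

variable {R₁ R₂ : Type*} [CommRing R₁] [IsDomain R₁] [IsDiscreteValuationRing R₁]
  [CommRing R₂] [IsDomain R₂] [IsDiscreteValuationRing R₂]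

/-- The number of distinct roots in an algebraic closure does not change under an embedding of
the coefficient field (here: the residue fields of two DVRs): the roots in `k̄₁` are carried
bijectively onto the roots in `k̄₂` by a `k₁`-embedding `k̄₁ → k̄₂` (`IsAlgClosed.lift`).
[folklore] -/
theorem distinctRootCount_map_ringHom (e : ResidueField R₁ →+* ResidueField R₂)
    (P : (ResidueField R₁)[X]) :
    distinctRootCount (R := R₂) (P.map e) = distinctRootCount P := by
  classical
  unfold distinctRootCount
  letI : Algebra (ResidueField R₁) (AlgebraicClosure (ResidueField R₂)) :=
    ((algebraMap (ResidueField R₂) (AlgebraicClosure (ResidueField R₂))).comp e).toAlgebra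
  let g : AlgebraicClosure (ResidueField R₁) →ₐ[ResidueField R₁]
      AlgebraicClosure (ResidueField R₂) := IsAlgClosed.lift
  have hsplit :
      (P.map (algebraMap (ResidueField R₁) (AlgebraicClosure (ResidueField R₁)))).Splits :=
    IsAlgClosed.splits _
  have himg := congrArg Set.ncard (hsplit.image_rootSet g)
  have hinj : Function.Injective g :=
    (g : AlgebraicClosure (ResidueField R₁) →+* AlgebraicClosure (ResidueField R₂)).injective
  rw [Set.ncard_image_of_injective _ hinj, rootSet_def, rootSet_def,
    Set.ncard_coe_finset, Set.ncard_coe_finset] at himg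
  have h1 : (P.map e).aroots (AlgebraicClosure (ResidueField R₂)) =
      P.aroots (AlgebraicClosure (ResidueField R₂)) := by
    rw [aroots_def, aroots_def, Polynomial.map_map]
    rfl
  rw [h1]
  exact himg.symm

/-- If `P(d T) = k · Q(T)` with `d, k ≠ 0` then `P` and `Q` have the same number of distinct roots
in `k̄`. [folklore] -/
theorem distinctRootCount_eq_of_comp_C_mul {R : Type*} [CommRing R] [IsDomain R]
    [IsDiscreteValuationRing R] {d k : ResidueField R} (hd : d ≠ 0) (hk : k ≠ 0)
    {P Q : (ResidueField R)[X]} (h : P.comp (C d * X) = C k * Q) :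
    distinctRootCount P = distinctRootCount Q := by
  rw [← distinctRootCount_C_mul_comp hd (inv_ne_zero hk) 0 P, map_zero, add_zero, h, ← mul_assoc,
    ← C_mul, inv_mul_cancel₀ hk, C_1, one_mul]

variable (ψ : R₁ ≃+* R₂) {w : R₂ˣ}

/-- The residue of the unit `w` is non-zero. [folklore] -/
theorem residue_units_ne_zero (w : R₂ˣ) : residue R₂ (w : R₂) ≠ 0 :=
  (residue_ne_zero_iff_isUnit _).mpr w.isUnit

/-- The step-6 cubic of `W.map ψ` (formed with the uniformiser `π₂` of `R₂`) has as many distinct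
roots in `k̄₂` as the step-6 cubic of `W` (formed with `π₁`) has in `k̄₁`: with `ψ π₁ = w π₂`
its coefficients are `w̄ʲ ψ̄ (a_{i,j})`, so it is `w̄³ · (ψ̄ P)(T / w̄)`. [folklore] -/
theorem distinctRootCount_cubicStep6_map (hw : ψ (uniformizer R₁) = ↑w * uniformizer R₂)
    (W : WeierstrassCurve R₁) :
    distinctRootCount (cubicStep6 (W.map (ψ : R₁ →+* R₂))) = distinctRootCount (cubicStep6 W) := by
  set e := ResidueField.map (ψ : R₁ →+* R₂) with he
  set c := residue R₂ (w : R₂) with hc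
  have hc0 : c ≠ 0 := residue_units_ne_zero w
  rw [← distinctRootCount_map_ringHom e (cubicStep6 W)]
  refine distinctRootCount_eq_of_comp_C_mul hc0 (pow_ne_zero 3 hc0) ?_
  simp only [cubicStep6, WeierstrassCurve.map_a₂, WeierstrassCurve.map_a₄,
    WeierstrassCurve.map_a₆, RingHom.coe_coe, redCoeff_map ψ hw, Polynomial.map_add,
    Polynomial.map_mul, Polynomial.map_pow, map_X, map_C, add_comp, mul_comp, pow_comp, X_comp,
    C_comp, C_mul, C_pow]
  rw [← hc, ← he]
  ring

/-- The first quadratic `Y² + a₃,ₘ₊₂ Y − a₆,₂ₘ₊₄` of round `m` of the `Iₙ*` sub-procedure (for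
`m = 0` also the step-8 quadratic) of `W.map ψ` versus that of `W`: same number of distinct roots
(it is `w̄^{2m+4} · (ψ̄ Q)(T / w̄^{m+2})`). [folklore] -/
theorem distinctRootCount_quadratic₁_map (hw : ψ (uniformizer R₁) = ↑w * uniformizer R₂)
    (W : WeierstrassCurve R₁) (m : ℕ) :
    distinctRootCount (X ^ 2 + C (redCoeff (W.map (ψ : R₁ →+* R₂)).a₃ (m + 2)) * X
        - C (redCoeff (W.map (ψ : R₁ →+* R₂)).a₆ (2 * m + 4))) =
      distinctRootCount
        (X ^ 2 + C (redCoeff W.a₃ (m + 2)) * X - C (redCoeff W.a₆ (2 * m + 4))) := by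
  set e := ResidueField.map (ψ : R₁ →+* R₂) with he
  set c := residue R₂ (w : R₂) with hc
  have hc0 : c ≠ 0 := residue_units_ne_zero w
  rw [← distinctRootCount_map_ringHom e (X ^ 2 + C (redCoeff W.a₃ (m + 2)) * X
    - C (redCoeff W.a₆ (2 * m + 4)))]
  refine distinctRootCount_eq_of_comp_C_mul (pow_ne_zero (m + 2) hc0)
    (pow_ne_zero (2 * m + 4) hc0) ?_
  simp only [WeierstrassCurve.map_a₃, WeierstrassCurve.map_a₆, RingHom.coe_coe, redCoeff_map ψ hw,
    Polynomial.map_add, Polynomial.map_sub, Polynomial.map_mul, Polynomial.map_pow, map_X, map_C,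
    add_comp, sub_comp, mul_comp, pow_comp, X_comp, C_comp, C_mul, C_pow]
  rw [← hc, ← he]
  ring

/-- The second quadratic `a₂,₁ X² + a₄,ₘ₊₃ X + a₆,₂ₘ₊₅` of round `m` of the `Iₙ*` sub-procedure of
`W.map ψ` versus that of `W`: same number of distinct roots
(it is `w̄^{2m+5} · (ψ̄ Q)(T / w̄^{m+2})`). [folklore] -/
theorem distinctRootCount_quadratic₂_map (hw : ψ (uniformizer R₁) = ↑w * uniformizer R₂)
    (W : WeierstrassCurve R₁) (m : ℕ) :
    distinctRootCount (C (redCoeff (W.map (ψ : R₁ →+* R₂)).a₂ 1) * X ^ 2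
        + C (redCoeff (W.map (ψ : R₁ →+* R₂)).a₄ (m + 3)) * X
        + C (redCoeff (W.map (ψ : R₁ →+* R₂)).a₆ (2 * m + 5))) =
      distinctRootCount (C (redCoeff W.a₂ 1) * X ^ 2 + C (redCoeff W.a₄ (m + 3)) * X
        + C (redCoeff W.a₆ (2 * m + 5))) := by
  set e := ResidueField.map (ψ : R₁ →+* R₂) with he
  set c := residue R₂ (w : R₂) with hc
  have hc0 : c ≠ 0 := residue_units_ne_zero w
  rw [← distinctRootCount_map_ringHom e (C (redCoeff W.a₂ 1) * X ^ 2
    + C (redCoeff W.a₄ (m + 3)) * X + C (redCoeff W.a₆ (2 * m + 5)))]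
  refine distinctRootCount_eq_of_comp_C_mul (pow_ne_zero (m + 2) hc0)
    (pow_ne_zero (2 * m + 5) hc0) ?_
  simp only [WeierstrassCurve.map_a₂, WeierstrassCurve.map_a₄, WeierstrassCurve.map_a₆,
    RingHom.coe_coe, redCoeff_map ψ hw, Polynomial.map_add, Polynomial.map_mul,
    Polynomial.map_pow, map_X, map_C, add_comp, mul_comp, pow_comp, X_comp, C_comp, C_mul, C_pow]
  rw [← hc, ← he]
  ring

/-- The step-8 quadratic of `W.map ψ` versus that of `W` (case `m = 0` of
`distinctRootCount_quadratic₁_map`). [folklore] -/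
theorem distinctRootCount_quadraticStep8_map (hw : ψ (uniformizer R₁) = ↑w * uniformizer R₂)
    (W : WeierstrassCurve R₁) :
    distinctRootCount (quadraticStep8 (W.map (ψ : R₁ →+* R₂))) =
      distinctRootCount (quadraticStep8 W) := by
  have h := distinctRootCount_quadratic₁_map ψ hw W 0
  simpa [quadraticStep8] using h

end RootCount

/-! ### Coupling a run over `R₁` with a run over `R₂` -/

section Coupling

variable {R₁ R₂ : Type*} [CommRing R₁] [IsDomain R₁] [IsDiscreteValuationRing R₁]
  [CommRing R₂] [IsDomain R₂] [IsDiscreteValuationRing R₂] (ψ : R₁ ≃+* R₂)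

omit [IsDomain R₁] [IsDiscreteValuationRing R₁] [IsDomain R₂] [IsDiscreteValuationRing R₂] in
/-- If `W' = E • ψW`, `W₁ = C • W`, `W₁' = C' • W'` then `W₁' = (C' E (ψC)⁻¹) • ψW₁`. [folklore] -/
theorem smul_map_eq_conj_smul {W W₁ : WeierstrassCurve R₁} {W' W₁' : WeierstrassCurve R₂}
    {E C' : WeierstrassCurve.VariableChange R₂} {C : WeierstrassCurve.VariableChange R₁}
    (hrel : W' = E • W.map (ψ : R₁ →+* R₂)) (h₁ : W₁ = C • W) (h₁' : W₁' = C' • W') :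
    W₁' = (C' * E * (C.map (ψ : R₁ →+* R₂))⁻¹) • W₁.map (ψ : R₁ →+* R₂) := by
  rw [h₁', hrel, h₁, ← WeierstrassCurve.map_variableChange, mul_smul, mul_smul, inv_smul_smul]

omit [IsDomain R₁] [IsDiscreteValuationRing R₁] [IsDomain R₂] [IsDiscreteValuationRing R₂] in
/-- The coupling changes keep `u = 1`. [folklore] -/
theorem conj_u_eq_one {E C' : WeierstrassCurve.VariableChange R₂}
    {C : WeierstrassCurve.VariableChange R₁} (hC' : C'.u = 1) (hE : E.u = 1) (hC : C.u = 1) :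
    (C' * E * (C.map (ψ : R₁ →+* R₂))⁻¹).u = 1 := by
  simp [WeierstrassCurve.VariableChange.mul_def, WeierstrassCurve.VariableChange.inv_def,
    WeierstrassCurve.VariableChange.map, hC', hE, hC]

/-- `ord Δ` is transported: `ord₂ Δ(ψW) = ord₁ Δ(W)`. [folklore] -/
theorem addVal_Δ_map_toNat (W : WeierstrassCurve R₁) :
    (IsDiscreteValuationRing.addVal R₂ (W.map (ψ : R₁ →+* R₂)).Δ).toNat =
      (IsDiscreteValuationRing.addVal R₁ W.Δ).toNat := by
  rw [WeierstrassCurve.map_Δ, RingHom.coe_coe, Literature.NumberTheory.DiophantineGeometry.MinimalDiscriminant.addVal_ringEquiv]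

variable {w : R₂ˣ}

/-- **The `Iₙ*` sub-procedure across `ψ`** (coupled induction on the fuel): if `W' = E • ψW`
with `E` a `u = 1` change over `R₂` and both `W` (over `R₁`) and `W'` (over `R₂`) are normalised
for the start of round `m`, then `istarIndexAux` returns the same value on both.  Same coupling
as `istarIndexAux_smul_eq`, the base model of the `R₂`-run being compared with the image
`ψWₖ` of the `R₁`-run (rigidity `dvd_r_s_t_of_step7/7b` over `R₂`, test invariance
`distinctRootCount_quadratic₁/₂_smul` over `R₂` and `…_map` across `ψ`).
Silverman ATAEC IV.9.4, Step 7. [cite: SilvermanATAEC1994, IV.9.4 Step 7] -/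
theorem istarIndexAux_map_eq [PerfectField (ResidueField R₁)] [PerfectField (ResidueField R₂)]
    (hw : ψ (uniformizer R₁) = ↑w * uniformizer R₂) (fuel : ℕ) :
    ∀ (m : ℕ) {W : WeierstrassCurve R₁} {W' : WeierstrassCurve R₂}
      {E : WeierstrassCurve.VariableChange R₂},
      W' = E • W.map (ψ : R₁ →+* R₂) → E.u = 1 →
      uniformizer R₁ ∣ W.a₁ → uniformizer R₁ ∣ W.a₂ → ¬ uniformizer R₁ ^ 2 ∣ W.a₂ →
      uniformizer R₁ ^ (m + 2) ∣ W.a₃ → uniformizer R₁ ^ (m + 3) ∣ W.a₄ →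
      uniformizer R₁ ^ (2 * m + 4) ∣ W.a₆ →
      uniformizer R₂ ∣ W'.a₁ → uniformizer R₂ ∣ W'.a₂ → ¬ uniformizer R₂ ^ 2 ∣ W'.a₂ →
      uniformizer R₂ ^ (m + 2) ∣ W'.a₃ → uniformizer R₂ ^ (m + 3) ∣ W'.a₄ →
      uniformizer R₂ ^ (2 * m + 4) ∣ W'.a₆ →
      istarIndexAux fuel m W' = istarIndexAux fuel m W := by
  classical
  induction fuel with
  | zero => intros; rw [istarIndexAux_zero, istarIndexAux_zero]
  | succ fuel ih =>
    intro m W W' E hrel hu h1 h2 h2n h3 h4 h6 h1' h2' h2n' h3' h4' h6'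
    rw [istarIndexAux_succ, istarIndexAux_succ]
    -- the image of the `R₁`-model and rigidity of `E`
    have v1 : uniformizer R₂ ∣ (W.map (ψ : R₁ →+* R₂)).a₁ := by
      rw [WeierstrassCurve.map_a₁, RingHom.coe_coe, dvd_map_iff]; exact h1
    have v2 : uniformizer R₂ ∣ (W.map (ψ : R₁ →+* R₂)).a₂ := by
      rw [WeierstrassCurve.map_a₂, RingHom.coe_coe, dvd_map_iff]; exact h2
    have v2n : ¬ uniformizer R₂ ^ 2 ∣ (W.map (ψ : R₁ →+* R₂)).a₂ := by
      rw [WeierstrassCurve.map_a₂, RingHom.coe_coe, pow_dvd_map_iff]; exact h2n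
    have v3 : uniformizer R₂ ^ (m + 2) ∣ (W.map (ψ : R₁ →+* R₂)).a₃ := by
      rw [WeierstrassCurve.map_a₃, RingHom.coe_coe, pow_dvd_map_iff]; exact h3
    have v4 : uniformizer R₂ ^ (m + 3) ∣ (W.map (ψ : R₁ →+* R₂)).a₄ := by
      rw [WeierstrassCurve.map_a₄, RingHom.coe_coe, pow_dvd_map_iff]; exact h4
    have v6 : uniformizer R₂ ^ (2 * m + 4) ∣ (W.map (ψ : R₁ →+* R₂)).a₆ := by
      rw [WeierstrassCurve.map_a₆, RingHom.coe_coe, pow_dvd_map_iff]; exact h6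
    rw [hrel] at h1' h2' h2n' h3' h4' h6'
    obtain ⟨hr, hs, ht⟩ := dvd_r_s_t_of_step7 hu v1 v2 v2n v3 v4 v6 h1' h2' h3' h4' h6'
    -- first test
    have iffA : distinctRootCount (X ^ 2 + C (redCoeff (E • W.map (ψ : R₁ →+* R₂)).a₃ (m + 2)) * X
        - C (redCoeff (E • W.map (ψ : R₁ →+* R₂)).a₆ (2 * m + 4))) = 2 ↔
        distinctRootCount (X ^ 2 + C (redCoeff W.a₃ (m + 2)) * X
        - C (redCoeff W.a₆ (2 * m + 4))) = 2 := by
      rw [distinctRootCount_quadratic₁_smul hu v1 v2 v3 v4 v6 hr hs ht,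
        distinctRootCount_quadratic₁_map ψ hw W m]
    rw [hrel]
    by_cases hA : distinctRootCount (X ^ 2 + C (redCoeff W.a₃ (m + 2)) * X
        - C (redCoeff W.a₆ (2 * m + 4))) = 2
    · rw [if_pos hA, if_pos (iffA.mpr hA)]
    have hA' := fun h => hA (iffA.mp h)
    rw [if_neg hA, if_neg hA']
    -- the `y`-translations exist on both sides
    have hexA := exists_normalize_istarA h1 h2 h3 h4 h6 hA
    have hexA' := exists_normalize_istarA h1' h2' h3' h4' h6' hA'
    rw [dif_pos hexA, dif_pos hexA']
    simp only []
    obtain ⟨k1, k2, k2n, k3, k4, k6⟩ := istarA_spec h1 h2 h2n h3 h4 h6 hexA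
    obtain ⟨k1', k2', k2n', k3', k4', k6'⟩ := istarA_spec h1' h2' h2n' h3' h4' h6' hexA'
    set W₁ := hexA.choose • W with hW₁
    set W₁' := hexA'.choose • (E • W.map (ψ : R₁ →+* R₂)) with hW₁'
    -- coupling of the translated models
    have hrel₁ : W₁' = (hexA'.choose * E * (hexA.choose.map (ψ : R₁ →+* R₂))⁻¹) •
        W₁.map (ψ : R₁ →+* R₂) := smul_map_eq_conj_smul ψ rfl hW₁ hW₁'
    have hu₁ : (hexA'.choose * E * (hexA.choose.map (ψ : R₁ →+* R₂))⁻¹).u = 1 :=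
      conj_u_eq_one ψ hexA'.choose_spec.1 hu hexA.choose_spec.1
    set E₁ := hexA'.choose * E * (hexA.choose.map (ψ : R₁ →+* R₂))⁻¹ with hE₁
    clear_value W₁ W₁' E₁
    have x1 : uniformizer R₂ ∣ (W₁.map (ψ : R₁ →+* R₂)).a₁ := by
      rw [WeierstrassCurve.map_a₁, RingHom.coe_coe, dvd_map_iff]; exact k1
    have x2 : uniformizer R₂ ∣ (W₁.map (ψ : R₁ →+* R₂)).a₂ := by
      rw [WeierstrassCurve.map_a₂, RingHom.coe_coe, dvd_map_iff]; exact k2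
    have x2n : ¬ uniformizer R₂ ^ 2 ∣ (W₁.map (ψ : R₁ →+* R₂)).a₂ := by
      rw [WeierstrassCurve.map_a₂, RingHom.coe_coe, pow_dvd_map_iff]; exact k2n
    have x3 : uniformizer R₂ ^ (m + 3) ∣ (W₁.map (ψ : R₁ →+* R₂)).a₃ := by
      rw [WeierstrassCurve.map_a₃, RingHom.coe_coe, pow_dvd_map_iff]; exact k3
    have x4 : uniformizer R₂ ^ (m + 3) ∣ (W₁.map (ψ : R₁ →+* R₂)).a₄ := by
      rw [WeierstrassCurve.map_a₄, RingHom.coe_coe, pow_dvd_map_iff]; exact k4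
    have x6 : uniformizer R₂ ^ (2 * m + 5) ∣ (W₁.map (ψ : R₁ →+* R₂)).a₆ := by
      rw [WeierstrassCurve.map_a₆, RingHom.coe_coe, pow_dvd_map_iff]; exact k6
    rw [hrel₁] at k1' k2' k2n' k3' k4' k6'
    obtain ⟨hr₁, hs₁, ht₁⟩ := dvd_r_s_t_of_step7b hu₁ x1 x2 x2n x3 x4 x6 k1' k2' k3' k4' k6'
    -- second test
    have iffB : distinctRootCount (C (redCoeff (E₁ • W₁.map (ψ : R₁ →+* R₂)).a₂ 1) * X ^ 2
        + C (redCoeff (E₁ • W₁.map (ψ : R₁ →+* R₂)).a₄ (m + 3)) * X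
        + C (redCoeff (E₁ • W₁.map (ψ : R₁ →+* R₂)).a₆ (2 * m + 5))) = 2 ↔
        distinctRootCount (C (redCoeff W₁.a₂ 1) * X ^ 2 + C (redCoeff W₁.a₄ (m + 3)) * X
        + C (redCoeff W₁.a₆ (2 * m + 5))) = 2 := by
      rw [distinctRootCount_quadratic₂_smul hu₁ x1 x2 x3 x4 x6 hr₁ hs₁ ht₁,
        distinctRootCount_quadratic₂_map ψ hw W₁ m]
    rw [hrel₁]
    by_cases hB : distinctRootCount (C (redCoeff W₁.a₂ 1) * X ^ 2 + C (redCoeff W₁.a₄ (m + 3)) * X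
        + C (redCoeff W₁.a₆ (2 * m + 5))) = 2
    · rw [if_pos hB, if_pos (iffB.mpr hB)]
    have hB' := fun h => hB (iffB.mp h)
    rw [if_neg hB, if_neg hB']
    -- the `x`-translations exist on both sides
    have hexB := exists_normalize_istarB k1 k2 k2n k3 k4 k6 hB
    have hexB' := exists_normalize_istarB k1' k2' k2n' k3' k4' k6' hB'
    rw [dif_pos hexB, dif_pos hexB']
    obtain ⟨j1, j2, j2n, j3, j4, j6⟩ := istarB_spec k1 k2 k2n k3 k4 k6 hexB
    obtain ⟨j1', j2', j2n', j3', j4', j6'⟩ := istarB_spec k1' k2' k2n' k3' k4' k6' hexB'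
    have hrel₂ : hexB'.choose • (E₁ • W₁.map (ψ : R₁ →+* R₂)) =
        (hexB'.choose * E₁ * (hexB.choose.map (ψ : R₁ →+* R₂))⁻¹) •
          (hexB.choose • W₁).map (ψ : R₁ →+* R₂) :=
      smul_map_eq_conj_smul ψ rfl rfl rfl
    exact ih (m + 1) hrel₂ (conj_u_eq_one ψ hexB'.choose_spec.1 hu₁ hexB.choose_spec.1)
      j1 j2 j2n j3 j4 j6 j1' j2' j2n' j3' j4' j6'

/-- **`istarIndex` across `ψ`**: for a step-6 normalised `W` over `R₁` and a step-6 normalised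
`W' = E • ψW` over `R₂` (`E` with `u = 1`) whose cubics have exactly two distinct roots, the
initial `x`-translations exist on both sides (perfect residue fields), the translated models
satisfy `π ∥ a₂`, and `istarIndexAux_map_eq` applies with the common fuel `ord Δ`.
Silverman ATAEC IV.9.4, Step 7. [cite: SilvermanATAEC1994, IV.9.4 Step 7] -/
theorem istarIndex_map_eq [PerfectField (ResidueField R₁)] [PerfectField (ResidueField R₂)]
    (hw : ψ (uniformizer R₁) = ↑w * uniformizer R₂) {W : WeierstrassCurve R₁}
    {W' : WeierstrassCurve R₂} {E : WeierstrassCurve.VariableChange R₂}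
    (hrel : W' = E • W.map (ψ : R₁ →+* R₂)) (hu : E.u = 1)
    (h1 : uniformizer R₁ ∣ W.a₁) (h2 : uniformizer R₁ ∣ W.a₂) (h3 : uniformizer R₁ ^ 2 ∣ W.a₃)
    (h4 : uniformizer R₁ ^ 2 ∣ W.a₄) (h6 : uniformizer R₁ ^ 3 ∣ W.a₆)
    (h1' : uniformizer R₂ ∣ W'.a₁) (h2' : uniformizer R₂ ∣ W'.a₂)
    (h3' : uniformizer R₂ ^ 2 ∣ W'.a₃) (h4' : uniformizer R₂ ^ 2 ∣ W'.a₄)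
    (h6' : uniformizer R₂ ^ 3 ∣ W'.a₆)
    (h7 : distinctRootCount (cubicStep6 W) = 2) (h7' : distinctRootCount (cubicStep6 W') = 2) :
    istarIndex W' = istarIndex W := by
  classical
  have hex := exists_variableChange_step7_of_dvd h1 h2 h3 h4 h6 h7
  have hex' := exists_variableChange_step7_of_dvd h1' h2' h3' h4' h6' h7'
  unfold istarIndex
  rw [dif_pos hex, dif_pos hex']
  simp only []
  have hf : (IsDiscreteValuationRing.addVal R₂ W'.Δ).toNat =
      (IsDiscreteValuationRing.addVal R₁ W.Δ).toNat := by
    rw [hrel, addVal_Δ_smul_toNat, addVal_Δ_map_toNat]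
  rw [hf]
  -- specs of the translated models
  obtain ⟨huC, m1, m2, m3, m4, m6⟩ := hex.choose_spec
  have k1 := mem_maximalIdeal_iff_dvd.mp m1
  have k2 := mem_maximalIdeal_iff_dvd.mp m2
  have k3 := mem_maximalIdeal_pow_iff_dvd.mp m3
  have k4 := mem_maximalIdeal_pow_iff_dvd.mp m4
  have k6 := mem_maximalIdeal_pow_iff_dvd.mp m6
  obtain ⟨huC', m1', m2', m3', m4', m6'⟩ := hex'.choose_spec
  have k1' := mem_maximalIdeal_iff_dvd.mp m1'
  have k2' := mem_maximalIdeal_iff_dvd.mp m2'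
  have k3' := mem_maximalIdeal_pow_iff_dvd.mp m3'
  have k4' := mem_maximalIdeal_pow_iff_dvd.mp m4'
  have k6' := mem_maximalIdeal_pow_iff_dvd.mp m6'
  have d23 : uniformizer R₁ ^ 2 ∣ uniformizer R₁ ^ 3 := pow_dvd_pow _ (by norm_num)
  have d34 : uniformizer R₁ ^ 3 ∣ uniformizer R₁ ^ 4 := pow_dvd_pow _ (by norm_num)
  have d23' : uniformizer R₂ ^ 2 ∣ uniformizer R₂ ^ 3 := pow_dvd_pow _ (by norm_num)
  have d34' : uniformizer R₂ ^ 3 ∣ uniformizer R₂ ^ 4 := pow_dvd_pow _ (by norm_num)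
  -- `π ∥ a₂` on the translated models (one ring at a time)
  have k2n : ¬ uniformizer R₁ ^ 2 ∣ (hex.choose • W).a₂ := by
    obtain ⟨hr, hs, ht⟩ := dvd_r_s_t_of_step6 huC h1 h2 h3 h4 h6 k1 k2 k3 (d23.trans k4)
      (d34.trans k6)
    refine not_sq_dvd_a₂_of_distinctRootCount_eq_two k4 k6 ?_
    rw [distinctRootCount_cubicStep6_smul huC h1 h2 h3 h4 h6 hr hs ht]; exact h7
  have k2n' : ¬ uniformizer R₂ ^ 2 ∣ (hex'.choose • W').a₂ := by
    obtain ⟨hr, hs, ht⟩ := dvd_r_s_t_of_step6 huC' h1' h2' h3' h4' h6' k1' k2' k3'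
      (d23'.trans k4') (d34'.trans k6')
    refine not_sq_dvd_a₂_of_distinctRootCount_eq_two k4' k6' ?_
    rw [distinctRootCount_cubicStep6_smul huC' h1' h2' h3' h4' h6' hr hs ht]; exact h7'
  have hrel₇ : hex'.choose • W' =
      (hex'.choose * E * (hex.choose.map (ψ : R₁ →+* R₂))⁻¹) •
        (hex.choose • W).map (ψ : R₁ →+* R₂) :=
    smul_map_eq_conj_smul ψ hrel rfl rfl
  exact istarIndexAux_map_eq ψ hw _ 0 hrel₇ (conj_u_eq_one ψ huC' hu huC) k1 k2 k2n k3 k4 k6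
    k1' k2' k2n' k3' k4' k6'

end Coupling

end TateAlgorithm

end Literature.NumberTheory.DiophantineGeometry

/-! ### The main theorem over a DVR -/

namespace WeierstrassCurve

open Literature.NumberTheory.DiophantineGeometry.TateAlgorithm

section DVR

variable {R₁ R₂ : Type*} [CommRing R₁] [IsDomain R₁] [IsDiscreteValuationRing R₁]
  [CommRing R₂] [IsDomain R₂] [IsDiscreteValuationRing R₂]

/-- **Tate's algorithm is equivariant under isomorphisms of DVRs** (perfect residue fields): for
a ring isomorphism `ψ : R₁ ≃+* R₂` of discrete valuation rings and any Weierstrass equation `W`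
over `R₁`, the literal implementation `WeierstrassCurve.kodairaSymbolOfMinimal` of steps 1–10 of
Silverman ATAEC IV.9.4 returns the same Kodaira symbol on `ψW` (run over `R₂`, with the
uniformiser `π₂` and the normalising translations chosen over `R₂`) as on `W` (run over `R₁`).
No minimality or `Δ ≠ 0` hypothesis is needed.  Proof: the two runs are coupled step by step as
in `kodairaSymbolOfMinimal_smul`; after each normalisation the `R₂`-model is `Eₖ • ψWₖ` for a
`u = 1` change `Eₖ` over `R₂` lying in the subgroup singled out by the rigidity lemmas
(`dvd_r_t_of_step2`, `dvd_r_s_t_of_step6/7/7b/8/9`, applied over `R₂`), under which every test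
is invariant, while the tests of `ψWₖ` (uniformiser `π₂ = w⁻¹ ψπ₁`) agree with those of `Wₖ`
(`…_map` lemmas: the auxiliary polynomials are twisted coefficientwise by powers of `w̄` and
pushed through `ψ̄ : k₁ → k₂`).  Tate 1975, §§7–8; Silverman ATAEC IV.9.4 and Rem. IV.9.5.
[cite: SilvermanATAEC1994, IV.9.4 (PDF pp. 344–346)] [cite: Tate1975, §§7–8] -/
theorem kodairaSymbolOfMinimal_map_ringEquiv [PerfectField (IsLocalRing.ResidueField R₁)]
    [PerfectField (IsLocalRing.ResidueField R₂)] (ψ : R₁ ≃+* R₂) (W : WeierstrassCurve R₁) :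
    (W.map (ψ : R₁ →+* R₂)).kodairaSymbolOfMinimal = W.kodairaSymbolOfMinimal := by
  classical
  obtain ⟨w, hw⟩ := exists_units_map_uniformizer ψ
  unfold kodairaSymbolOfMinimal
  simp only []
  -- Step 1
  have i1 : (W.map (ψ : R₁ →+* R₂)).Δ ∉ maximalIdeal R₂ ↔ W.Δ ∉ maximalIdeal R₁ := by
    rw [map_Δ, RingHom.coe_coe, map_mem_maximalIdeal_iff]
  by_cases h1 : W.Δ ∉ maximalIdeal R₁
  · rw [if_pos h1, if_pos (i1.mpr h1)]
  rw [if_neg h1, if_neg (fun h => h1 (i1.mp h))]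
  have hΔ : W.Δ ∈ maximalIdeal R₁ := not_not.mp h1
  have hΔ' : (W.map (ψ : R₁ →+* R₂)).Δ ∈ maximalIdeal R₂ := not_not.mp (fun h => h1 (i1.mp h))
  -- Step 2 normalisations
  have hex2 := exists_variableChange_step2_of_perfectField W hΔ
  have hex2' := exists_variableChange_step2_of_perfectField (W.map (ψ : R₁ →+* R₂)) hΔ'
  have e2 : normalizeStep2 W = hex2.choose • W := by
    unfold normalizeStep2; rw [dif_pos hex2]
  have e2' : normalizeStep2 (W.map (ψ : R₁ →+* R₂)) = hex2'.choose • W.map (ψ : R₁ →+* R₂) := by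
    unfold normalizeStep2; rw [dif_pos hex2']
  rw [e2, e2', addVal_Δ_map_toNat ψ W]
  obtain ⟨hu2, p3, p4, p6⟩ := hex2.choose_spec
  have n3 := mem_maximalIdeal_iff_dvd.mp p3
  have n4 := mem_maximalIdeal_iff_dvd.mp p4
  have n6 := mem_maximalIdeal_iff_dvd.mp p6
  obtain ⟨hu2', p3', p4', p6'⟩ := hex2'.choose_spec
  have n3' := mem_maximalIdeal_iff_dvd.mp p3'
  have n4' := mem_maximalIdeal_iff_dvd.mp p4'
  have n6' := mem_maximalIdeal_iff_dvd.mp p6'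
  set W₂ := hex2.choose • W with hW₂
  set W₂' := hex2'.choose • W.map (ψ : R₁ →+* R₂) with hW₂'
  have hrel₂ : W₂' = (hex2'.choose * 1 * (hex2.choose.map (ψ : R₁ →+* R₂))⁻¹) •
      W₂.map (ψ : R₁ →+* R₂) :=
    smul_map_eq_conj_smul ψ (one_smul _ _).symm hW₂ hW₂'
  have hu₂ : (hex2'.choose * 1 * (hex2.choose.map (ψ : R₁ →+* R₂))⁻¹).u = 1 :=
    conj_u_eq_one ψ hu2' rfl hu2
  set E₂ := hex2'.choose * 1 * (hex2.choose.map (ψ : R₁ →+* R₂))⁻¹ with hE₂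
  clear_value W₂ W₂' E₂
  have v3 : uniformizer R₂ ∣ (W₂.map (ψ : R₁ →+* R₂)).a₃ := by
    rw [map_a₃, RingHom.coe_coe, dvd_map_iff]; exact n3
  have v4 : uniformizer R₂ ∣ (W₂.map (ψ : R₁ →+* R₂)).a₄ := by
    rw [map_a₄, RingHom.coe_coe, dvd_map_iff]; exact n4
  have v6 : uniformizer R₂ ∣ (W₂.map (ψ : R₁ →+* R₂)).a₆ := by
    rw [map_a₆, RingHom.coe_coe, dvd_map_iff]; exact n6
  have m3' : uniformizer R₂ ∣ (E₂ • W₂.map (ψ : R₁ →+* R₂)).a₃ := hrel₂ ▸ n3'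
  have m4' : uniformizer R₂ ∣ (E₂ • W₂.map (ψ : R₁ →+* R₂)).a₄ := hrel₂ ▸ n4'
  have m6' : uniformizer R₂ ∣ (E₂ • W₂.map (ψ : R₁ →+* R₂)).a₆ := hrel₂ ▸ n6'
  obtain ⟨hr₂, ht₂⟩ := dvd_r_t_of_step2 hu₂ v3 v4 v6 m3' m4' m6'
  -- Step 2 test
  have i2 : W₂'.b₂ ∉ maximalIdeal R₂ ↔ W₂.b₂ ∉ maximalIdeal R₁ := by
    rw [mem_maximalIdeal_iff_dvd, mem_maximalIdeal_iff_dvd, hrel₂, dvd_b₂_smul_iff hu₂ hr₂, map_b₂,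
      RingHom.coe_coe, dvd_map_iff]
  by_cases h2 : W₂.b₂ ∉ maximalIdeal R₁
  · rw [if_pos h2, if_pos (i2.mpr h2)]
  rw [if_neg h2, if_neg (fun h => h2 (i2.mp h))]
  have hb₂ : uniformizer R₁ ∣ W₂.b₂ := mem_maximalIdeal_iff_dvd.mp (not_not.mp h2)
  have hb₂' : uniformizer R₂ ∣ W₂'.b₂ :=
    mem_maximalIdeal_iff_dvd.mp (not_not.mp (fun h => h2 (i2.mp h)))
  have vb₂ : uniformizer R₂ ∣ (W₂.map (ψ : R₁ →+* R₂)).b₂ := by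
    rw [map_b₂, RingHom.coe_coe, dvd_map_iff]; exact hb₂
  -- Step 3 test
  have i3 : W₂'.a₆ ∉ maximalIdeal R₂ ^ 2 ↔ W₂.a₆ ∉ maximalIdeal R₁ ^ 2 := by
    rw [mem_maximalIdeal_pow_iff_dvd, mem_maximalIdeal_pow_iff_dvd, hrel₂,
      sq_dvd_a₆_smul_iff hu₂ v3 v4 hr₂ ht₂, map_a₆, RingHom.coe_coe, pow_dvd_map_iff]
  by_cases h3 : W₂.a₆ ∉ maximalIdeal R₁ ^ 2
  · rw [if_pos h3, if_pos (i3.mpr h3)]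
  rw [if_neg h3, if_neg (fun h => h3 (i3.mp h))]
  have ha₆ : uniformizer R₁ ^ 2 ∣ W₂.a₆ := mem_maximalIdeal_pow_iff_dvd.mp (not_not.mp h3)
  have ha₆' : uniformizer R₂ ^ 2 ∣ W₂'.a₆ :=
    mem_maximalIdeal_pow_iff_dvd.mp (not_not.mp (fun h => h3 (i3.mp h)))
  have va₆ : uniformizer R₂ ^ 2 ∣ (W₂.map (ψ : R₁ →+* R₂)).a₆ := by
    rw [map_a₆, RingHom.coe_coe, pow_dvd_map_iff]; exact ha₆
  -- Step 4 test
  have i4 : W₂'.b₈ ∉ maximalIdeal R₂ ^ 3 ↔ W₂.b₈ ∉ maximalIdeal R₁ ^ 3 := by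
    rw [mem_maximalIdeal_pow_iff_dvd, mem_maximalIdeal_pow_iff_dvd, hrel₂,
      cube_dvd_b₈_smul_iff hu₂ v3 v4 va₆ hr₂, map_b₈, RingHom.coe_coe, pow_dvd_map_iff]
  by_cases h4 : W₂.b₈ ∉ maximalIdeal R₁ ^ 3
  · rw [if_pos h4, if_pos (i4.mpr h4)]
  rw [if_neg h4, if_neg (fun h => h4 (i4.mp h))]
  have hb₈ : uniformizer R₁ ^ 3 ∣ W₂.b₈ := mem_maximalIdeal_pow_iff_dvd.mp (not_not.mp h4)
  have hb₈' : uniformizer R₂ ^ 3 ∣ W₂'.b₈ :=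
    mem_maximalIdeal_pow_iff_dvd.mp (not_not.mp (fun h => h4 (i4.mp h)))
  have vb₈ : uniformizer R₂ ^ 3 ∣ (W₂.map (ψ : R₁ →+* R₂)).b₈ := by
    rw [map_b₈, RingHom.coe_coe, pow_dvd_map_iff]; exact hb₈
  -- Step 5 test
  have i5 : W₂'.b₆ ∉ maximalIdeal R₂ ^ 3 ↔ W₂.b₆ ∉ maximalIdeal R₁ ^ 3 := by
    rw [mem_maximalIdeal_pow_iff_dvd, mem_maximalIdeal_pow_iff_dvd, hrel₂,
      cube_dvd_b₆_smul_iff hu₂ v3 va₆ vb₂ vb₈ hr₂, map_b₆, RingHom.coe_coe, pow_dvd_map_iff]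
  by_cases h5 : W₂.b₆ ∉ maximalIdeal R₁ ^ 3
  · rw [if_pos h5, if_pos (i5.mpr h5)]
  rw [if_neg h5, if_neg (fun h => h5 (i5.mp h))]
  have hb₆ : uniformizer R₁ ^ 3 ∣ W₂.b₆ := mem_maximalIdeal_pow_iff_dvd.mp (not_not.mp h5)
  have hb₆' : uniformizer R₂ ^ 3 ∣ W₂'.b₆ :=
    mem_maximalIdeal_pow_iff_dvd.mp (not_not.mp (fun h => h5 (i5.mp h)))
  -- Step 6 normalisations
  have hex6 := exists_variableChange_step6_of_dvd n3 n4 ha₆ hb₂ hb₆ hb₈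
  have hex6' := exists_variableChange_step6_of_dvd n3' n4' ha₆' hb₂' hb₆' hb₈'
  have e6 : normalizeStep6 W₂ = hex6.choose • W₂ := by
    unfold normalizeStep6; rw [dif_pos hex6]
  have e6' : normalizeStep6 W₂' = hex6'.choose • W₂' := by
    unfold normalizeStep6; rw [dif_pos hex6']
  rw [e6, e6']
  obtain ⟨hu6, s1, s2, s3, s4, s6⟩ := hex6.choose_spec
  have q1 := mem_maximalIdeal_iff_dvd.mp s1
  have q2 := mem_maximalIdeal_iff_dvd.mp s2
  have q3 := mem_maximalIdeal_pow_iff_dvd.mp s3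
  have q4 := mem_maximalIdeal_pow_iff_dvd.mp s4
  have q6 := mem_maximalIdeal_pow_iff_dvd.mp s6
  obtain ⟨hu6', s1', s2', s3', s4', s6'⟩ := hex6'.choose_spec
  have q1' := mem_maximalIdeal_iff_dvd.mp s1'
  have q2' := mem_maximalIdeal_iff_dvd.mp s2'
  have q3' := mem_maximalIdeal_pow_iff_dvd.mp s3'
  have q4' := mem_maximalIdeal_pow_iff_dvd.mp s4'
  have q6' := mem_maximalIdeal_pow_iff_dvd.mp s6'
  set W₆ := hex6.choose • W₂ with hW₆
  set W₆' := hex6'.choose • W₂' with hW₆'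
  have hrel₆ : W₆' = (hex6'.choose * E₂ * (hex6.choose.map (ψ : R₁ →+* R₂))⁻¹) •
      W₆.map (ψ : R₁ →+* R₂) :=
    smul_map_eq_conj_smul ψ hrel₂ hW₆ hW₆'
  have hu₆ : (hex6'.choose * E₂ * (hex6.choose.map (ψ : R₁ →+* R₂))⁻¹).u = 1 :=
    conj_u_eq_one ψ hu6' hu₂ hu6
  set E₆ := hex6'.choose * E₂ * (hex6.choose.map (ψ : R₁ →+* R₂))⁻¹ with hE₆
  clear_value W₆ W₆' E₆
  have x1 : uniformizer R₂ ∣ (W₆.map (ψ : R₁ →+* R₂)).a₁ := by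
    rw [map_a₁, RingHom.coe_coe, dvd_map_iff]; exact q1
  have x2 : uniformizer R₂ ∣ (W₆.map (ψ : R₁ →+* R₂)).a₂ := by
    rw [map_a₂, RingHom.coe_coe, dvd_map_iff]; exact q2
  have x3 : uniformizer R₂ ^ 2 ∣ (W₆.map (ψ : R₁ →+* R₂)).a₃ := by
    rw [map_a₃, RingHom.coe_coe, pow_dvd_map_iff]; exact q3
  have x4 : uniformizer R₂ ^ 2 ∣ (W₆.map (ψ : R₁ →+* R₂)).a₄ := by
    rw [map_a₄, RingHom.coe_coe, pow_dvd_map_iff]; exact q4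
  have x6 : uniformizer R₂ ^ 3 ∣ (W₆.map (ψ : R₁ →+* R₂)).a₆ := by
    rw [map_a₆, RingHom.coe_coe, pow_dvd_map_iff]; exact q6
  have y1' : uniformizer R₂ ∣ (E₆ • W₆.map (ψ : R₁ →+* R₂)).a₁ := hrel₆ ▸ q1'
  have y2' : uniformizer R₂ ∣ (E₆ • W₆.map (ψ : R₁ →+* R₂)).a₂ := hrel₆ ▸ q2'
  have y3' : uniformizer R₂ ^ 2 ∣ (E₆ • W₆.map (ψ : R₁ →+* R₂)).a₃ := hrel₆ ▸ q3'
  have y4' : uniformizer R₂ ^ 2 ∣ (E₆ • W₆.map (ψ : R₁ →+* R₂)).a₄ := hrel₆ ▸ q4'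
  have y6' : uniformizer R₂ ^ 3 ∣ (E₆ • W₆.map (ψ : R₁ →+* R₂)).a₆ := hrel₆ ▸ q6'
  obtain ⟨hr₆, hs₆, ht₆⟩ := dvd_r_s_t_of_step6 hu₆ x1 x2 x3 x4 x6 y1' y2' y3' y4' y6'
  -- Steps 6 and 7 tests
  have c6 : distinctRootCount (cubicStep6 W₆') = distinctRootCount (cubicStep6 W₆) := by
    rw [hrel₆, distinctRootCount_cubicStep6_smul hu₆ x1 x2 x3 x4 x6 hr₆ hs₆ ht₆,
      distinctRootCount_cubicStep6_map ψ hw W₆]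
  by_cases h6 : distinctRootCount (cubicStep6 W₆) = 3
  · rw [if_pos h6, if_pos (c6.trans h6)]
  have h6' : distinctRootCount (cubicStep6 W₆') ≠ 3 := fun h => h6 (c6.symm.trans h)
  rw [if_neg h6, if_neg h6']
  by_cases h7 : distinctRootCount (cubicStep6 W₆) = 2
  · rw [if_pos h7, if_pos (c6.trans h7),
      istarIndex_map_eq ψ hw hrel₆ hu₆ q1 q2 q3 q4 q6 q1' q2' q3' q4' q6' h7 (c6.trans h7)]
  have h7' : distinctRootCount (cubicStep6 W₆') ≠ 2 := fun h => h7 (c6.symm.trans h)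
  rw [if_neg h7, if_neg h7']
  -- Step 8 normalisations
  have hex8 := exists_variableChange_step8_of_dvd q1 q2 q3 q4 q6 h6 h7
  have hex8' := exists_variableChange_step8_of_dvd q1' q2' q3' q4' q6' h6' h7'
  have e8 : normalizeStep8 W₆ = hex8.choose • W₆ := by
    unfold normalizeStep8; rw [dif_pos hex8]
  have e8' : normalizeStep8 W₆' = hex8'.choose • W₆' := by
    unfold normalizeStep8; rw [dif_pos hex8']
  rw [e8, e8']
  obtain ⟨hu8, t1, t2, t3, t4, t6⟩ := hex8.choose_spec
  have y1 := mem_maximalIdeal_iff_dvd.mp t1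
  have y2 := mem_maximalIdeal_pow_iff_dvd.mp t2
  have y3 := mem_maximalIdeal_pow_iff_dvd.mp t3
  have y4 := mem_maximalIdeal_pow_iff_dvd.mp t4
  have y6 := mem_maximalIdeal_pow_iff_dvd.mp t6
  obtain ⟨hu8', t1', t2', t3', t4', t6'⟩ := hex8'.choose_spec
  have y1'' := mem_maximalIdeal_iff_dvd.mp t1'
  have y2'' := mem_maximalIdeal_pow_iff_dvd.mp t2'
  have y3'' := mem_maximalIdeal_pow_iff_dvd.mp t3'
  have y4'' := mem_maximalIdeal_pow_iff_dvd.mp t4'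
  have y6'' := mem_maximalIdeal_pow_iff_dvd.mp t6'
  set W₈ := hex8.choose • W₆ with hW₈
  set W₈' := hex8'.choose • W₆' with hW₈'
  have hrel₈ : W₈' = (hex8'.choose * E₆ * (hex8.choose.map (ψ : R₁ →+* R₂))⁻¹) •
      W₈.map (ψ : R₁ →+* R₂) :=
    smul_map_eq_conj_smul ψ hrel₆ hW₈ hW₈'
  have hu₈ : (hex8'.choose * E₆ * (hex8.choose.map (ψ : R₁ →+* R₂))⁻¹).u = 1 :=
    conj_u_eq_one ψ hu8' hu₆ hu8
  set E₈ := hex8'.choose * E₆ * (hex8.choose.map (ψ : R₁ →+* R₂))⁻¹ with hE₈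
  clear_value W₈ W₈' E₈
  have hd12 : uniformizer R₂ ∣ uniformizer R₂ ^ 2 := dvd_pow_self _ two_ne_zero
  have z1 : uniformizer R₂ ∣ (W₈.map (ψ : R₁ →+* R₂)).a₁ := by
    rw [map_a₁, RingHom.coe_coe, dvd_map_iff]; exact y1
  have z2 : uniformizer R₂ ^ 2 ∣ (W₈.map (ψ : R₁ →+* R₂)).a₂ := by
    rw [map_a₂, RingHom.coe_coe, pow_dvd_map_iff]; exact y2
  have z3 : uniformizer R₂ ^ 2 ∣ (W₈.map (ψ : R₁ →+* R₂)).a₃ := by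
    rw [map_a₃, RingHom.coe_coe, pow_dvd_map_iff]; exact y3
  have z4 : uniformizer R₂ ^ 3 ∣ (W₈.map (ψ : R₁ →+* R₂)).a₄ := by
    rw [map_a₄, RingHom.coe_coe, pow_dvd_map_iff]; exact y4
  have z6 : uniformizer R₂ ^ 4 ∣ (W₈.map (ψ : R₁ →+* R₂)).a₆ := by
    rw [map_a₆, RingHom.coe_coe, pow_dvd_map_iff]; exact y6
  have z1' : uniformizer R₂ ∣ (E₈ • W₈.map (ψ : R₁ →+* R₂)).a₁ := hrel₈ ▸ y1''
  have z2' : uniformizer R₂ ^ 2 ∣ (E₈ • W₈.map (ψ : R₁ →+* R₂)).a₂ := hrel₈ ▸ y2''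
  have z3' : uniformizer R₂ ^ 2 ∣ (E₈ • W₈.map (ψ : R₁ →+* R₂)).a₃ := hrel₈ ▸ y3''
  have z4' : uniformizer R₂ ^ 3 ∣ (E₈ • W₈.map (ψ : R₁ →+* R₂)).a₄ := hrel₈ ▸ y4''
  have z6' : uniformizer R₂ ^ 4 ∣ (E₈ • W₈.map (ψ : R₁ →+* R₂)).a₆ := hrel₈ ▸ y6''
  obtain ⟨hr₈, hs₈, ht₈⟩ := dvd_r_s_t_of_step8 hu₈ z1 z2 z3 z4 z6 z1' z2' z3' z4' z6'
  -- Step 8 test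
  have c8 : distinctRootCount (quadraticStep8 W₈') = distinctRootCount (quadraticStep8 W₈) := by
    rw [hrel₈, distinctRootCount_quadraticStep8_smul hu₈ z1 (hd12.trans z2) z3 z4 z6 hr₈ hs₈ ht₈,
      distinctRootCount_quadraticStep8_map ψ hw W₈]
  by_cases h8 : distinctRootCount (quadraticStep8 W₈) = 2
  · rw [if_pos h8, if_pos (c8.trans h8)]
  have h8' : distinctRootCount (quadraticStep8 W₈') ≠ 2 := fun h => h8 (c8.symm.trans h)
  rw [if_neg h8, if_neg h8']
  -- Step 9 normalisations
  have hex9 := exists_variableChange_step9_of_dvd y1 y2 y3 y4 y6 h8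
  have hex9' := exists_variableChange_step9_of_dvd y1'' y2'' y3'' y4'' y6'' h8'
  have e9 : normalizeStep9 W₈ = hex9.choose • W₈ := by
    unfold normalizeStep9; rw [dif_pos hex9]
  have e9' : normalizeStep9 W₈' = hex9'.choose • W₈' := by
    unfold normalizeStep9; rw [dif_pos hex9']
  rw [e9, e9']
  obtain ⟨hu9, o1, o2, o3, o4, o6⟩ := hex9.choose_spec
  have g1 := mem_maximalIdeal_iff_dvd.mp o1
  have g2 := mem_maximalIdeal_pow_iff_dvd.mp o2
  have g3 := mem_maximalIdeal_pow_iff_dvd.mp o3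
  have g4 := mem_maximalIdeal_pow_iff_dvd.mp o4
  have g6 := mem_maximalIdeal_pow_iff_dvd.mp o6
  obtain ⟨hu9', o1', o2', o3', o4', o6'⟩ := hex9'.choose_spec
  have g1' := mem_maximalIdeal_iff_dvd.mp o1'
  have g2' := mem_maximalIdeal_pow_iff_dvd.mp o2'
  have g3' := mem_maximalIdeal_pow_iff_dvd.mp o3'
  have g4' := mem_maximalIdeal_pow_iff_dvd.mp o4'
  have g6' := mem_maximalIdeal_pow_iff_dvd.mp o6'
  set W₉ := hex9.choose • W₈ with hW₉
  set W₉' := hex9'.choose • W₈' with hW₉'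
  have hrel₉ : W₉' = (hex9'.choose * E₈ * (hex9.choose.map (ψ : R₁ →+* R₂))⁻¹) •
      W₉.map (ψ : R₁ →+* R₂) :=
    smul_map_eq_conj_smul ψ hrel₈ hW₉ hW₉'
  have hu₉ : (hex9'.choose * E₈ * (hex9.choose.map (ψ : R₁ →+* R₂))⁻¹).u = 1 :=
    conj_u_eq_one ψ hu9' hu₈ hu9
  set E₉ := hex9'.choose * E₈ * (hex9.choose.map (ψ : R₁ →+* R₂))⁻¹ with hE₉
  clear_value W₉ W₉' E₉
  have f1 : uniformizer R₂ ∣ (W₉.map (ψ : R₁ →+* R₂)).a₁ := by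
    rw [map_a₁, RingHom.coe_coe, dvd_map_iff]; exact g1
  have f2 : uniformizer R₂ ^ 2 ∣ (W₉.map (ψ : R₁ →+* R₂)).a₂ := by
    rw [map_a₂, RingHom.coe_coe, pow_dvd_map_iff]; exact g2
  have f3 : uniformizer R₂ ^ 3 ∣ (W₉.map (ψ : R₁ →+* R₂)).a₃ := by
    rw [map_a₃, RingHom.coe_coe, pow_dvd_map_iff]; exact g3
  have f4 : uniformizer R₂ ^ 3 ∣ (W₉.map (ψ : R₁ →+* R₂)).a₄ := by
    rw [map_a₄, RingHom.coe_coe, pow_dvd_map_iff]; exact g4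
  have f6 : uniformizer R₂ ^ 5 ∣ (W₉.map (ψ : R₁ →+* R₂)).a₆ := by
    rw [map_a₆, RingHom.coe_coe, pow_dvd_map_iff]; exact g6
  have f1' : uniformizer R₂ ∣ (E₉ • W₉.map (ψ : R₁ →+* R₂)).a₁ := hrel₉ ▸ g1'
  have f2' : uniformizer R₂ ^ 2 ∣ (E₉ • W₉.map (ψ : R₁ →+* R₂)).a₂ := hrel₉ ▸ g2'
  have f3' : uniformizer R₂ ^ 3 ∣ (E₉ • W₉.map (ψ : R₁ →+* R₂)).a₃ := hrel₉ ▸ g3'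
  have f4' : uniformizer R₂ ^ 3 ∣ (E₉ • W₉.map (ψ : R₁ →+* R₂)).a₄ := hrel₉ ▸ g4'
  have f6' : uniformizer R₂ ^ 5 ∣ (E₉ • W₉.map (ψ : R₁ →+* R₂)).a₆ := hrel₉ ▸ g6'
  obtain ⟨hr₉, hs₉, ht₉⟩ := dvd_r_s_t_of_step9 hu₉ f1 f2 f3 f4 f6 f1' f2' f3' f4' f6'
  -- Step 9 test
  have i9 : W₉'.a₄ ∉ maximalIdeal R₂ ^ 4 ↔ W₉.a₄ ∉ maximalIdeal R₁ ^ 4 := by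
    rw [mem_maximalIdeal_pow_iff_dvd, mem_maximalIdeal_pow_iff_dvd, hrel₉,
      pow_four_dvd_a₄_smul_iff hu₉ f1 f2 f3 hr₉ hs₉ ht₉, map_a₄, RingHom.coe_coe, pow_dvd_map_iff]
  by_cases h9 : W₉.a₄ ∉ maximalIdeal R₁ ^ 4
  · rw [if_pos h9, if_pos (i9.mpr h9)]
  rw [if_neg h9, if_neg (fun h => h9 (i9.mp h))]
  have ha₄ : uniformizer R₁ ^ 4 ∣ W₉.a₄ := mem_maximalIdeal_pow_iff_dvd.mp (not_not.mp h9)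
  have fa₄ : uniformizer R₂ ^ 4 ∣ (W₉.map (ψ : R₁ →+* R₂)).a₄ := by
    rw [map_a₄, RingHom.coe_coe, pow_dvd_map_iff]; exact ha₄
  -- Step 10 test
  have i10 : W₉'.a₆ ∉ maximalIdeal R₂ ^ 6 ↔ W₉.a₆ ∉ maximalIdeal R₁ ^ 6 := by
    rw [mem_maximalIdeal_pow_iff_dvd, mem_maximalIdeal_pow_iff_dvd, hrel₉,
      pow_six_dvd_a₆_smul_iff hu₉ f1 f2 f3 fa₄ hr₉ ht₉, map_a₆, RingHom.coe_coe, pow_dvd_map_iff]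
  by_cases h10 : W₉.a₆ ∉ maximalIdeal R₁ ^ 6
  · rw [if_pos h10, if_pos (i10.mpr h10)]
  rw [if_neg h10, if_neg (fun h => h10 (i10.mp h))]

end DVR

/-! ### Over the fraction fields: `kodairaSymbol` and `kodairaSymbolAt` -/

section Fraction

variable {R₁ K₁ R₂ K₂ : Type*}
  [CommRing R₁] [IsDomain R₁] [IsDiscreteValuationRing R₁] [Field K₁] [Algebra R₁ K₁]
  [IsFractionRing R₁ K₁]
  [CommRing R₂] [IsDomain R₂] [IsDiscreteValuationRing R₂] [Field K₂] [Algebra R₂ K₂]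
  [IsFractionRing R₂ K₂]
  (ψ : R₁ ≃+* R₂) (φ : K₁ ≃+* K₂)
  (hc : ∀ r : R₁, φ (algebraMap R₁ K₁ r) = algebraMap R₂ K₂ (ψ r))

omit [IsDomain R₁] [IsDiscreteValuationRing R₁] [IsFractionRing R₁ K₁] [IsDomain R₂]
  [IsDiscreteValuationRing R₂] in
include hc in
/-- Integral models are transported along compatible ring isomorphisms `(R₁ ⊆ K₁) ≃ (R₂ ⊆ K₂)`:
the (unique) integral model of `φM` is `ψ` of the integral model of `M`.  (Same statement as
`WeierstrassCurve.integralModel_map_ringEquiv` of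
`Literature.NumberTheory.EllipticCurves.BSDRootNumberPrimesEquivProofs`, which this
`DiophantineGeometry` file must not import.) [folklore] -/
theorem integralModel_map_eq_map_integralModel (M : WeierstrassCurve K₁) [IsIntegral R₁ M]
    [IsIntegral R₂ (M.map (φ : K₁ →+* K₂))] :
    integralModel R₂ (M.map (φ : K₁ →+* K₂)) = (integralModel R₁ M).map (ψ : R₁ →+* R₂) := by
  apply map_injective (IsFractionRing.injective R₂ K₂)
  have h₂ := baseChange_integralModel_eq R₂ (M.map (φ : K₁ →+* K₂))
  have h₁ := baseChange_integralModel_eq R₁ M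
  rw [WeierstrassCurve.baseChange] at h₂ h₁
  have hcomp : (algebraMap R₂ K₂).comp (ψ : R₁ →+* R₂) =
      (φ : K₁ →+* K₂).comp (algebraMap R₁ K₁) := by
    ext r
    exact (hc r).symm
  change (integralModel R₂ (M.map (φ : K₁ →+* K₂))).map (algebraMap R₂ K₂) =
    ((integralModel R₁ M).map (ψ : R₁ →+* R₂)).map (algebraMap R₂ K₂)
  rw [h₂, map_map, hcomp, ← map_map, h₁]

include ψ hc in
/-- **The Kodaira symbol is intrinsic to the valued field** (perfect residue fields): for
compatible ring isomorphisms `(R₁ ⊆ K₁) ≃ (R₂ ⊆ K₂)` of DVR / fraction-field pairs and an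
`X : WeierstrassCurve K₁` with `Δ ≠ 0`, Tate's algorithm gives the same Kodaira symbol for
`φX` over `R₂` as for `X` over `R₁`.  The chosen minimal models `(φX).minimal R₂` and
`φ (X.minimal R₁)` are minimal equations of the same elliptic curve over `K₂`
(`isMinimal_map_ringEquiv`), so their integral models differ by a change of variables over `R₂`
(Silverman AEC VII.1.3(b), `exists_variableChange_integralModel_eq`) and
`kodairaSymbolOfMinimal_smul` applies; the integral model of `φ (X.minimal R₁)` is `ψ` of that
of `X.minimal R₁`, to which `kodairaSymbolOfMinimal_map_ringEquiv` applies.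
Tate 1975, §§7–8; Silverman ATAEC IV.9.4, Rem. IV.9.5.
[cite: SilvermanATAEC1994, IV.9.4 (PDF pp. 344–346)] [cite: Tate1975, §§7–8] -/
theorem kodairaSymbol_map_ringEquiv [PerfectField (IsLocalRing.ResidueField R₁)]
    [PerfectField (IsLocalRing.ResidueField R₂)] (X : WeierstrassCurve K₁) (hΔ : X.Δ ≠ 0) :
    (X.map (φ : K₁ →+* K₂)).kodairaSymbol R₂ = X.kodairaSymbol R₁ := by
  unfold kodairaSymbol
  set C₁ := (X.exists_isMinimal R₁).choose
  set C₂ := ((X.map (φ : K₁ →+* K₂)).exists_isMinimal R₂).choose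
  have hM₁ : X.minimal R₁ = C₁ • X := rfl
  have hM₂ : (X.map (φ : K₁ →+* K₂)).minimal R₂ = C₂ • X.map (φ : K₁ →+* K₂) := rfl
  haveI hmin₁ : IsMinimal R₂ ((X.minimal R₁).map (φ : K₁ →+* K₂)) :=
    isMinimal_map_ringEquiv ψ φ hc _
  have hrel : (X.map (φ : K₁ →+* K₂)).minimal R₂ =
      (C₂ * (C₁.map (φ : K₁ →+* K₂))⁻¹) • (X.minimal R₁).map (φ : K₁ →+* K₂) := by
    rw [hM₂, hM₁, ← map_variableChange, smul_smul, inv_mul_cancel_right]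
  have hΔ' : ((X.minimal R₁).map (φ : K₁ →+* K₂)).Δ ≠ 0 := by
    rw [map_Δ, hM₁, variableChange_Δ]
    exact (map_ne_zero_iff _ (φ : K₁ →+* K₂).injective).mpr
      (mul_ne_zero (pow_ne_zero _ (Units.ne_zero _)) hΔ)
  obtain ⟨D', -, hD'⟩ := exists_variableChange_integralModel_eq R₂ hrel hΔ'
  rw [hD', kodairaSymbolOfMinimal_smul, integralModel_map_eq_map_integralModel ψ φ hc,
    kodairaSymbolOfMinimal_map_ringEquiv ψ]

end Fraction

/-! ### Places of `ℚ`: Tate's algorithm at `v` computed in `ℚ_p` -/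

section Padic

open IsDedekindDomain Rat.HeightOneSpectrum

variable {R : Type*} [CommRing R] [IsDedekindDomain R] [Algebra R ℚ] [IsFractionRing R ℚ]
  [IsIntegralClosure R ℤ ℚ]

/-- **Tate's algorithm at `v` computed in `ℚ_p`.**  For an elliptic `W / ℚ`, an integer ring `R`
of `ℚ` (`R = ℤ` or `R = 𝓞 ℚ`) and a finite place `v` of `R` above `p = primesEquiv v`, the Kodaira
symbol `W.kodairaSymbolAt v` (Tate's algorithm over the completed local ring
`v.adicCompletionIntegers ℚ`) is the Kodaira symbol of `W ⊗ ℚ_[p]` computed over Mathlib's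
`ℤ_[p]`: transport along `v.adicCompletion ℚ ≃A[ℚ] ℚ_[p]` and
`v.adicCompletionIntegers ℚ ≃A[ℤ] ℤ_[p]` (`Rat.HeightOneSpectrum.adicCompletion.padicEquiv`,
`…adicCompletionIntegers.padicIntEquiv`) by `kodairaSymbol_map_ringEquiv` (both residue fields
are finite, hence perfect); the base changes of `W` correspond because `ℚ →+* ℚ_[p]` is unique.
In particular the Kodaira symbol at `p` does not depend on whether `p` is viewed as a prime of
`ℤ` or of `𝓞 ℚ`.  (`Fact p.Prime` is supplied inline.)  Tate 1975, §§7–8; Silverman ATAEC IV.9.4.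
[cite: SilvermanATAEC1994, IV.9.4 (PDF pp. 344–346)] [cite: Tate1975, §§7–8] -/
theorem kodairaSymbolAt_eq_padic (v : HeightOneSpectrum R) (W : WeierstrassCurve ℚ)
    [W.IsElliptic] :
    haveI : Fact (primesEquiv v).1.Prime := ⟨(primesEquiv v).2⟩
    W.kodairaSymbolAt v = (W.baseChange ℚ_[primesEquiv v]).kodairaSymbol ℤ_[primesEquiv v] := by
  have _inst (p : Nat.Primes) : Fact p.1.Prime := ⟨p.2⟩
  haveI : Finite (IsLocalRing.ResidueField ℤ_[primesEquiv v]) :=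
    Finite.of_equiv _ (PadicInt.residueField (p := primesEquiv v)).toEquiv.symm
  unfold kodairaSymbolAt
  have hc : ∀ r : v.adicCompletionIntegers ℚ,
      (adicCompletion.padicEquiv v).toRingEquiv (algebraMap _ (v.adicCompletion ℚ) r) =
        algebraMap ℤ_[primesEquiv v] ℚ_[primesEquiv v]
          ((adicCompletionIntegers.padicIntEquiv v).toRingEquiv r) := fun r ↦ rfl
  have hΔ : (W.baseChange (v.adicCompletion ℚ)).Δ ≠ 0 := by
    rw [WeierstrassCurve.baseChange, map_Δ]
    exact (map_ne_zero_iff _ (algebraMap ℚ (v.adicCompletion ℚ)).injective).mpr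
      W.isUnit_Δ.ne_zero
  have key := kodairaSymbol_map_ringEquiv (adicCompletionIntegers.padicIntEquiv v).toRingEquiv
    (adicCompletion.padicEquiv v).toRingEquiv hc (W.baseChange (v.adicCompletion ℚ)) hΔ
  rw [← key, WeierstrassCurve.baseChange, WeierstrassCurve.baseChange, map_map]
  congr 2
  exact Subsingleton.elim _ _

end Padic

end WeierstrassCurve
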